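import Literature.MathematicalPhysics.QuantumLattice.SchwartzPartition
import Literature.MathematicalPhysics.QuantumLattice.SchwartzTranslationCutoff
import Mathlib.Analysis.Calculus.BumpFunction.FiniteDimension
import Mathlib.MeasureTheory.Integral.DominatedConvergence
import Mathlib.Topology.MetricSpace.Pseudo.Lemmas
import HarnessLib

/-!
# From local to global densities of a distribution on an open set

Trunk **T-AQFT** (Schwartz-space support file, sequel of `SchwartzPartition` and
`SchwartzTranslationCutoff`). A standard localisation fact used whenever a density of a
distribution is produced *locally* (e.g. the real-analytic densities of the Schwinger functions of
Osterwalder–Schrader II, Thm. 4.1, which are constructed chart by chart): let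
`T : 𝓢(V, ℂ) →L[ℂ] ℂ`, `U ⊆ V` open, `S` continuous on `U`, and suppose every point of `U` has a
ball `B ⊆ U` with `T F = ∫ S F` for all `F ∈ 𝓢` supported in `B`. Then

* `apply_eq_integral_of_localDensity_of_hasCompactSupport` — `T F = ∫ S F` for every `F ∈ 𝓢` with
  compact support contained in `U` (Lebesgue number of the cover of `supp F` by the balls, and the
  lattice partition of unity `latticeBump` of `SchwartzPartition` at a scale finer than it:
  `F = ∑_β η_β F`, finitely many terms, each supported in one ball);
* `apply_eq_integral_of_localDensity` — `T F = ∫ S F` for every `F ∈ 𝓢` with `tsupport F ⊆ U`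
  such that `S · F` is integrable (the compactly supported cutoffs `χ(x/(m+1)) F → F` in `𝓢`,
  `tendsto_smulLeftCLM_of_eq_one`, and dominated convergence on the right).

No compatibility of the local densities is assumed beyond their being restrictions of the one
function `S`; the measure is any measure finite on compact sets.

## References

* L. Hörmander, *The Analysis of Linear Partial Differential Operators I*, 2nd ed. (1990),
  Thm. 1.4.4–1.4.5 (partitions of unity) and Thm. 2.2.1/§2.1 (a distribution is determined by,
  and assembled from, its restrictions to an open cover). [HormanderALPDO1]
-/

noncomputable section

open scoped SchwartzMap Topology ContDiff
open Filter Set Metric MeasureTheory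

namespace Literature.MathematicalPhysics.QuantumLattice

variable {V : Type*} [NormedAddCommGroup V] [NormedSpace ℝ V]

/-! ### Scaled lattice partitions with small supports -/

section Scaled

variable {m : ℕ} (Λ : V ≃L[ℝ] EuclideanSpace ℝ (Fin m))

/-- **Diameter of the supports of the lattice bumps**: two points of `supp η_β` are at distance at
most `‖Λ⁻¹‖ · 2√m`. [folklore] -/
theorem dist_le_of_mem_tsupport_latticeBump {β : Fin m → ℤ} {y y' : V}
    (hy : y ∈ tsupport (latticeBump Λ β)) (hy' : y' ∈ tsupport (latticeBump Λ β)) :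
    dist y y' ≤ ‖(Λ.symm : EuclideanSpace ℝ (Fin m) →L[ℝ] V)‖ * (√m * 2) := by
  have h := tsupport_latticeBump_subset Λ β hy
  have h' := tsupport_latticeBump_subset Λ β hy'
  have hz : ‖Λ (y - y')‖ ≤ √m * 2 := by
    have := EuclideanSpace.norm_le_sqrt_card_mul (Λ (y - y')) (by norm_num : (0 : ℝ) ≤ 2) fun c => by
      have h1 := mem_Icc.1 (h c)
      have h2 := mem_Icc.1 (h' c)
      have h3 : (Λ (y - y')) c = (Λ y) c - (Λ y') c := by simp [map_sub]
      rw [h3, abs_le]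
      constructor <;> linarith [h1.1, h1.2, h2.1, h2.2]
    simpa using this
  calc dist y y' = ‖Λ.symm (Λ (y - y'))‖ := by rw [ContinuousLinearEquiv.symm_apply_apply, dist_eq_norm]
    _ ≤ ‖(Λ.symm : EuclideanSpace ℝ (Fin m) →L[ℝ] V)‖ * ‖Λ (y - y')‖ :=
        Λ.symm.toContinuousLinearMap.le_opNorm _
    _ ≤ ‖(Λ.symm : EuclideanSpace ℝ (Fin m) →L[ℝ] V)‖ * (√m * 2) := by gcongr

/-- **Coordinates at scale `1/s`**: `Λ_s = s • Λ` (the dilation `z ↦ s • z` of `ℝᵐ` being the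
unit `s ∈ ℝˣ` acting by `ContinuousLinearEquiv.smulLeft`); the lattice bumps of `Λ_s` have supports
of diameter `≤ ‖Λ⁻¹‖ · 2√m / s < δ`. [folklore] -/
theorem dist_lt_of_mem_tsupport_latticeBump_scaled {s δ : ℝ} (hs : 0 < s)
    (hδ : ‖(Λ.symm : EuclideanSpace ℝ (Fin m) →L[ℝ] V)‖ * (√m * 2) < δ * s) {β : Fin m → ℤ} {y y' : V}
    (hy : y ∈ tsupport (latticeBump
      (Λ.trans (ContinuousLinearEquiv.smulLeft (Units.mk0 s hs.ne') :
        EuclideanSpace ℝ (Fin m) ≃L[ℝ] EuclideanSpace ℝ (Fin m))) β))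
    (hy' : y' ∈ tsupport (latticeBump
      (Λ.trans (ContinuousLinearEquiv.smulLeft (Units.mk0 s hs.ne') :
        EuclideanSpace ℝ (Fin m) ≃L[ℝ] EuclideanSpace ℝ (Fin m))) β)) : dist y y' < δ := by
  set Λs := Λ.trans (ContinuousLinearEquiv.smulLeft (Units.mk0 s hs.ne') :
        EuclideanSpace ℝ (Fin m) ≃L[ℝ] EuclideanSpace ℝ (Fin m)) with hΛs
  have h := tsupport_latticeBump_subset Λs β hy
  have h' := tsupport_latticeBump_subset Λs β hy'
  have hz : ‖Λ (y - y')‖ * s ≤ √m * 2 := by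
    have h0 := EuclideanSpace.norm_le_sqrt_card_mul (Λs (y - y')) (by norm_num : (0 : ℝ) ≤ 2) fun c => by
      have h1 := mem_Icc.1 (h c)
      have h2 := mem_Icc.1 (h' c)
      have h3 : (Λs (y - y')) c = (Λs y) c - (Λs y') c := by simp [map_sub]
      rw [h3, abs_le]
      constructor <;> linarith [h1.1, h1.2, h2.1, h2.2]
    have h3 : Λs (y - y') = s • Λ (y - y') := rfl
    rw [h3, norm_smul, Real.norm_of_nonneg hs.le] at h0
    simpa [mul_comm] using h0
  have hd : dist y y' ≤ ‖(Λ.symm : EuclideanSpace ℝ (Fin m) →L[ℝ] V)‖ * ‖Λ (y - y')‖ := by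
    calc dist y y' = ‖Λ.symm (Λ (y - y'))‖ := by rw [ContinuousLinearEquiv.symm_apply_apply, dist_eq_norm]
      _ ≤ ‖(Λ.symm : EuclideanSpace ℝ (Fin m) →L[ℝ] V)‖ * ‖Λ (y - y')‖ :=
          Λ.symm.toContinuousLinearMap.le_opNorm _
  have hN : 0 ≤ ‖(Λ.symm : EuclideanSpace ℝ (Fin m) →L[ℝ] V)‖ := norm_nonneg _
  by_contra hcon
  push Not at hcon
  have h4 : δ * s ≤ ‖(Λ.symm : EuclideanSpace ℝ (Fin m) →L[ℝ] V)‖ * ‖Λ (y - y')‖ * s := by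
    have := mul_le_mul_of_nonneg_right (hcon.trans hd) hs.le
    linarith
  have h5 : ‖(Λ.symm : EuclideanSpace ℝ (Fin m) →L[ℝ] V)‖ * ‖Λ (y - y')‖ * s ≤
      ‖(Λ.symm : EuclideanSpace ℝ (Fin m) →L[ℝ] V)‖ * (√m * 2) := by
    rw [mul_assoc]
    exact mul_le_mul_of_nonneg_left hz hN
  linarith

end Scaled

/-! ### The lattice bumps as Schwartz multipliers -/

section Multipliers

variable {m : ℕ} (Λ : V ≃L[ℝ] EuclideanSpace ℝ (Fin m))

/-- The complexified lattice bump `y ↦ (η_β y : ℂ)` is smooth. [folklore] -/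
theorem contDiff_latticeBumpC (β : Fin m → ℤ) : ContDiff ℝ ∞ fun y => ((latticeBump Λ β y : ℝ) : ℂ) :=
  contDiff_ofReal_comp ℂ (contDiff_latticeBump Λ β)

/-- The complexified lattice bump has compact support. [folklore] -/
theorem hasCompactSupport_latticeBumpC [FiniteDimensional ℝ V] (β : Fin m → ℤ) :
    HasCompactSupport fun y => ((latticeBump Λ β y : ℝ) : ℂ) :=
  (hasCompactSupport_latticeBump Λ β).comp_left Complex.ofReal_zero

/-- The complexified lattice bump has temperate growth. [folklore] -/
theorem hasTemperateGrowth_latticeBumpC [FiniteDimensional ℝ V] (β : Fin m → ℤ) :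
    Function.HasTemperateGrowth fun y => ((latticeBump Λ β y : ℝ) : ℂ) :=
  (hasCompactSupport_latticeBumpC Λ β).hasTemperateGrowth (contDiff_latticeBumpC Λ β)

/-- The support of the complexified bump is that of the bump. [folklore] -/
theorem tsupport_latticeBumpC (β : Fin m → ℤ) :
    tsupport (fun y => ((latticeBump Λ β y : ℝ) : ℂ)) = tsupport (latticeBump Λ β) := by
  unfold tsupport
  congr 1
  ext y
  simp [Function.mem_support]

end Multipliers

/-! ### Compactly supported test functions -/

/-- A product `S · G` with `G` continuous, `tsupport G ⊆ U`, `U` open and `S` continuous on `U`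
is continuous. [folklore] -/
theorem continuous_mul_of_continuousOn_tsupport_subset {X : Type*} [TopologicalSpace X] {U : Set X}
    (hU : IsOpen U) {S G : X → ℂ}
    (hS : ContinuousOn S U) (hG : Continuous G) (hsupp : tsupport G ⊆ U) :
    Continuous fun y => S y * G y := by
  refine continuous_iff_continuousAt.2 fun x => ?_
  by_cases hx : x ∈ tsupport G
  · exact (hS.continuousAt (hU.mem_nhds (hsupp hx))).mul hG.continuousAt
  · have hG0 : G =ᶠ[𝓝 x] 0 := notMem_tsupport_iff_eventuallyEq.1 hx
    refine Filter.EventuallyEq.continuousAt (y := 0) ?_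
    filter_upwards [hG0] with y hy
    simp [hy]

variable [FiniteDimensional ℝ V] [MeasurableSpace V] [BorelSpace V]

/-- **Local densities give the global density on compactly supported test functions.** Let
`T : 𝓢(V, ℂ) →L[ℂ] ℂ`, `U` open, `S` continuous on `U`, and suppose each `x ∈ U` has a ball
`B(x, ρ) ⊆ U` with `T F = ∫ S F ∂μ` for all `F ∈ 𝓢` with `tsupport F ⊆ B(x, ρ)`. Then
`T F = ∫ S F ∂μ` for every `F ∈ 𝓢` with compact support contained in `U` (Hörmander I, §2.1–2.2:
a distribution is assembled from its restrictions to an open cover by a partition of unity). [cite: HormanderALPDO1, Thm 2.2.1] -/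
theorem apply_eq_integral_of_localDensity_of_hasCompactSupport (μ : Measure V)
    [IsFiniteMeasureOnCompacts μ] (T : 𝓢(V, ℂ) →L[ℂ] ℂ) {U : Set V} (hU : IsOpen U) {S : V → ℂ}
    (hS : ContinuousOn S U)
    (hloc : ∀ x ∈ U, ∃ ρ : ℝ, 0 < ρ ∧ ball x ρ ⊆ U ∧
      ∀ F : 𝓢(V, ℂ), tsupport (F : V → ℂ) ⊆ ball x ρ → T F = ∫ y, S y * F y ∂μ)
    (F : 𝓢(V, ℂ)) (hF : HasCompactSupport (F : V → ℂ)) (hFU : tsupport (F : V → ℂ) ⊆ U) :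
    T F = ∫ y, S y * F y ∂μ := by
  classical
  set K : Set V := tsupport (F : V → ℂ) with hK
  have hKc : IsCompact K := hF
  -- the radii of the local representations
  choose! ρ hρ hρU hrep using hloc
  -- Lebesgue number of the cover of `K` by the balls
  obtain ⟨δ, hδ, hLeb⟩ : ∃ δ > 0, ∀ y ∈ K, ∃ x : U, ball y δ ⊆ ball (x : V) (ρ x) := by
    refine lebesgue_number_lemma_of_metric hKc (fun x : U => isOpen_ball) fun y hy => ?_
    exact mem_iUnion.2 ⟨⟨y, hFU hy⟩, mem_ball_self (hρ y (hFU hy))⟩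
  -- linear coordinates at a scale finer than `δ`
  set m : ℕ := Module.finrank ℝ V with hm
  let Λ₀ : V ≃L[ℝ] EuclideanSpace ℝ (Fin m) := ContinuousLinearEquiv.ofFinrankEq (by simp [hm])
  set A : ℝ := ‖(Λ₀.symm : EuclideanSpace ℝ (Fin m) →L[ℝ] V)‖ * (√m * 2) with hA
  have hA0 : 0 ≤ A := by positivity
  set s : ℝ := (A + 1) / δ with hs
  have hspos : 0 < s := by positivity
  have hAs : A < δ * s := by
    rw [hs, mul_div_cancel₀ _ hδ.ne']
    linarith
  set Λ : V ≃L[ℝ] EuclideanSpace ℝ (Fin m) := Λ₀.trans (ContinuousLinearEquiv.smulLeft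
    (Units.mk0 s hspos.ne') : EuclideanSpace ℝ (Fin m) ≃L[ℝ] EuclideanSpace ℝ (Fin m)) with hΛ
  have hsmall : ∀ (β : Fin m → ℤ) (y y' : V), y ∈ tsupport (latticeBump Λ β) →
      y' ∈ tsupport (latticeBump Λ β) → dist y y' < δ := fun β y y' hy hy' =>
    dist_lt_of_mem_tsupport_latticeBump_scaled Λ₀ hspos hAs hy hy'
  -- a window equal to one on `K`
  obtain ⟨B, hB⟩ : ∃ B : ℝ, ∀ y ∈ K, ‖y‖ ≤ B := by
    obtain ⟨B, hB⟩ := hKc.isBounded.exists_norm_le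
    exact ⟨B, hB⟩
  set L : ℝ := ‖(Λ : V →L[ℝ] EuclideanSpace ℝ (Fin m))‖ + 1 with hL
  have hL0 : 0 < L := by positivity
  set R : ℕ := ⌈max B 0 * L⌉₊ with hR
  have hwin : ∀ y ∈ K, latticeWindow Λ R y = 1 := by
    intro y hy
    refine latticeWindow_eq_one Λ ?_
    rw [le_div_iff₀ hL0]
    calc ‖y‖ * L ≤ max B 0 * L := by
          gcongr
          exact (hB y hy).trans (le_max_left _ _)
      _ ≤ R := Nat.le_ceil _
  -- the pieces `η_β F`
  set η : (Fin m → ℤ) → V → ℂ := fun β y => ((latticeBump Λ β y : ℝ) : ℂ) with hη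
  have hηt : ∀ β, (η β).HasTemperateGrowth := fun β => hasTemperateGrowth_latticeBumpC Λ β
  set G : (Fin m → ℤ) → 𝓢(V, ℂ) := fun β => SchwartzMap.smulLeftCLM ℂ (η β) F with hG
  have hGapply : ∀ β y, G β y = η β y * F y := fun β y => by
    rw [hG]; exact SchwartzMap.smulLeftCLM_apply_apply (hηt β) F y
  have hGsupp : ∀ β, tsupport (G β : V → ℂ) ⊆ K ∩ tsupport (latticeBump Λ β) := fun β => by
    have h := SchwartzMap.tsupport_smulLeftCLM_subset (F := ℂ) (η β) F
    rw [tsupport_latticeBumpC Λ β] at h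
    exact h
  -- pointwise decomposition `F = ∑_{β ∈ cube} η_β F`
  have hsum : ∀ y, F y = ∑ β ∈ latticeCube m R, G β y := by
    intro y
    simp_rw [hGapply, ← Finset.sum_mul]
    by_cases hy : y ∈ K
    · have h1 : ∑ β ∈ latticeCube m R, η β y = 1 := by
        rw [hη]
        simp only
        rw [← Complex.ofReal_sum, sum_latticeCube_latticeBump Λ R y, hwin y hy, Complex.ofReal_one]
      rw [h1, one_mul]
    · rw [image_eq_zero_of_notMem_tsupport hy, mul_zero]
  -- each piece is represented
  have hpiece : ∀ β, T (G β) = ∫ y, S y * G β y ∂μ := by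
    intro β
    by_cases hne : (K ∩ tsupport (latticeBump Λ β)).Nonempty
    · obtain ⟨y₀, hy₀K, hy₀β⟩ := hne
      obtain ⟨x, hx⟩ := hLeb y₀ hy₀K
      refine hrep x x.2 (G β) ((hGsupp β).trans fun y hy => hx ?_)
      rw [mem_ball, dist_comm]
      exact hsmall β y₀ y hy₀β hy.2
    · have h0 : G β = 0 := by
        ext y
        have hy : y ∉ tsupport (G β : V → ℂ) := fun h => hne ⟨y, hGsupp β h⟩
        exact image_eq_zero_of_notMem_tsupport hy
      rw [h0, map_zero]
      simp
  -- integrability of the pieces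
  have hint : ∀ β ∈ latticeCube m R, Integrable (fun y => S y * G β y) μ := by
    intro β _
    have hc : Continuous fun y => S y * G β y :=
      continuous_mul_of_continuousOn_tsupport_subset hU hS (G β).continuous
        ((hGsupp β).trans (inter_subset_left.trans hFU))
    refine hc.integrable_of_hasCompactSupport ?_
    refine HasCompactSupport.intro (hKc) fun y hy => ?_
    have hy' : y ∉ tsupport (G β : V → ℂ) := fun h => hy (hGsupp β h).1
    rw [image_eq_zero_of_notMem_tsupport hy', mul_zero]
  -- assemble
  have hFsum : F = ∑ β ∈ latticeCube m R, G β := by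
    ext y
    rw [hsum y]
    simp
  calc T F = ∑ β ∈ latticeCube m R, T (G β) := by rw [hFsum, map_sum]
    _ = ∑ β ∈ latticeCube m R, ∫ y, S y * G β y ∂μ := Finset.sum_congr rfl fun β _ => hpiece β
    _ = ∫ y, ∑ β ∈ latticeCube m R, S y * G β y ∂μ := (integral_finsetSum _ hint).symm
    _ = ∫ y, S y * F y ∂μ := by
        refine integral_congr_ae (Eventually.of_forall fun y => ?_)
        simp only
        rw [hsum y, Finset.mul_sum]

/-! ### General test functions supported in `U` -/

omit [MeasurableSpace V] [BorelSpace V] in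
/-- **Compactly supported cutoffs dominated by the function**: for `F ∈ 𝓢(V, ℂ)` there are
`u m ∈ 𝓢` with compact support inside `tsupport F`, `‖u m y‖ ≤ ‖F y‖`, `u m y → F y`, and
`u m → F` in `𝓢` (the bump cutoffs `χ(y/(m+1)) F(y)`; Hörmander I, Lemma 7.1.8). [folklore] -/
theorem exists_cutoff_seq (F : 𝓢(V, ℂ)) :
    ∃ u : ℕ → 𝓢(V, ℂ), (∀ m, HasCompactSupport (u m : V → ℂ)) ∧
      (∀ m, tsupport (u m : V → ℂ) ⊆ tsupport (F : V → ℂ)) ∧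
      (∀ m y, ‖u m y‖ ≤ ‖F y‖) ∧ (∀ y, Tendsto (fun m => u m y) atTop (𝓝 (F y))) ∧
      Tendsto u atTop (𝓝 F) := by
  let χ : ContDiffBump (0 : V) := ⟨1, 2, one_pos, one_lt_two⟩
  have hRm : ∀ m : ℕ, (0 : ℝ) < m + 1 := fun m => by positivity
  let Lm : ℕ → V →L[ℝ] V := fun m => ((m : ℝ) + 1)⁻¹ • ContinuousLinearMap.id ℝ V
  let χR : ℕ → V → ℝ := fun m => (χ : V → ℝ) ∘ Lm m
  have hχR_apply : ∀ m x, χR m x = χ (((m : ℝ) + 1)⁻¹ • x) := fun m x => rfl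
  have hχ_smooth : ContDiff ℝ ∞ (χ : V → ℝ) := χ.contDiff
  have hχR_smooth : ∀ m, ContDiff ℝ ∞ (χR m) := fun m => hχ_smooth.comp (Lm m).contDiff
  have hχR_one : ∀ (m : ℕ) (x : V), ‖x‖ ≤ (m : ℝ) + 1 → χR m x = 1 := by
    intro m x hx
    apply χ.one_of_mem_closedBall
    change ((m : ℝ) + 1)⁻¹ • x ∈ closedBall (0 : V) 1
    rw [mem_closedBall_zero_iff, norm_smul, norm_inv, Real.norm_of_nonneg (hRm m).le,
      inv_mul_le_iff₀ (hRm m), mul_one]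
    exact hx
  have hχR_zero : ∀ (m : ℕ) (x : V), 2 * ((m : ℝ) + 1) < ‖x‖ → χR m x = 0 := by
    intro m x hx
    have hx' : ((m : ℝ) + 1)⁻¹ • x ∉ Function.support (χ : V → ℝ) := by
      rw [χ.support_eq, mem_ball_zero_iff, norm_smul, norm_inv, Real.norm_of_nonneg (hRm m).le,
        not_lt, le_inv_mul_iff₀ (hRm m)]
      change ((m : ℝ) + 1) * 2 ≤ ‖x‖
      linarith
    rw [Function.mem_support, not_not] at hx'
    exact hx'
  have hχR_supp : ∀ m, HasCompactSupport (χR m) := fun m =>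
    HasCompactSupport.intro (isCompact_closedBall (0 : V) (2 * ((m : ℝ) + 1))) fun x hx =>
      hχR_zero m x (by simpa [mem_closedBall_zero_iff] using hx)
  -- the complexified cutoffs
  set W : ℕ → V → ℂ := fun m x => ((χR m x : ℝ) : ℂ) with hW
  have hW_smooth : ∀ m, ContDiff ℝ ∞ (W m) := fun m => contDiff_ofReal_comp ℂ (hχR_smooth m)
  have hW_supp : ∀ m, HasCompactSupport (W m) := fun m => (hχR_supp m).comp_left Complex.ofReal_zero
  have hW_temp : ∀ m, (W m).HasTemperateGrowth := fun m => (hW_supp m).hasTemperateGrowth (hW_smooth m)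
  -- uniform derivative bounds
  have hM : ∀ i : ℕ, ∃ M : ℝ, ∀ y, ‖iteratedFDeriv ℝ i (χ : V → ℝ) y‖ ≤ M := fun i => by
    obtain ⟨x₀, hx₀⟩ := ((hχ_smooth.continuous_iteratedFDeriv (m := i)
      (by exact_mod_cast le_top)).norm).exists_forall_ge_of_hasCompactSupport
      ((χ.hasCompactSupport.iteratedFDeriv i).norm)
    exact ⟨_, hx₀⟩
  choose M hM using hM
  have hL1 : ∀ m, ‖Lm m‖ ≤ 1 := by
    intro m
    change ‖((m : ℝ) + 1)⁻¹ • ContinuousLinearMap.id ℝ V‖ ≤ 1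
    refine (ContinuousLinearMap.opNorm_smul_le _ _).trans ?_
    rw [norm_inv, Real.norm_of_nonneg (hRm m).le]
    calc ((m : ℝ) + 1)⁻¹ * ‖ContinuousLinearMap.id ℝ V‖ ≤ 1 * 1 :=
          mul_le_mul (inv_le_one_of_one_le₀ (by linarith [(m.cast_nonneg : (0 : ℝ) ≤ m)]))
            ContinuousLinearMap.norm_id_le (norm_nonneg _) zero_le_one
      _ = 1 := one_mul 1
  have hDW : ∀ m i x, ‖iteratedFDeriv ℝ i (W m) x‖ ≤ M i := fun m i x =>
    (norm_iteratedFDeriv_ofReal_comp ℂ (hχR_smooth m) i x).trans_le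
      ((norm_iteratedFDeriv_comp_clm_le hχ_smooth (Lm m) (hL1 m) i x).trans (hM i _))
  refine ⟨fun m => SchwartzMap.smulLeftCLM ℂ (W m) F, fun m => ?_, fun m => ?_, fun m y => ?_, fun y => ?_, ?_⟩
  · exact IsCompact.of_isClosed_subset (hW_supp m) (isClosed_tsupport _)
      ((SchwartzMap.tsupport_smulLeftCLM_subset (F := ℂ) (W m) F).trans inter_subset_right)
  · exact (SchwartzMap.tsupport_smulLeftCLM_subset (F := ℂ) (W m) F).trans inter_subset_left
  · rw [SchwartzMap.smulLeftCLM_apply_apply (hW_temp m), hW]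
    simp only [smul_eq_mul, norm_mul, Complex.norm_real, Real.norm_eq_abs]
    have h1 : |χR m y| ≤ 1 := by
      rw [hχR_apply, abs_of_nonneg (χ.nonneg' _)]
      exact χ.le_one
    calc |χR m y| * ‖F y‖ ≤ 1 * ‖F y‖ := by gcongr
      _ = ‖F y‖ := one_mul _
  · have hev : ∀ᶠ m : ℕ in atTop, SchwartzMap.smulLeftCLM ℂ (W m) F y = F y := by
      filter_upwards [Filter.eventually_ge_atTop ⌈‖y‖⌉₊] with m hm
      rw [SchwartzMap.smulLeftCLM_apply_apply (hW_temp m), hW]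
      simp only
      rw [hχR_one m y ((Nat.le_ceil _).trans (by exact_mod_cast Nat.le_succ_of_le hm)),
        Complex.ofReal_one, one_smul]
    exact tendsto_const_nhds.congr' (hev.mono fun m hm => hm.symm)
  · exact tendsto_smulLeftCLM_of_eq_one ℂ F W hW_smooth hW_temp M hDW (fun m : ℕ => (m : ℝ) + 1)
      (tendsto_natCast_atTop_atTop.atTop_add tendsto_const_nhds) fun m x hx => by
        rw [hW]; simp only; rw [hχR_one m x hx, Complex.ofReal_one]

/-- **Local densities give the global density**: under the hypotheses of
`apply_eq_integral_of_localDensity_of_hasCompactSupport`, `T F = ∫ S F ∂μ` for every `F ∈ 𝓢`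
with `tsupport F ⊆ U` such that `S · F` is integrable (no compact support: approximate `F` in
`𝓢` by its compactly supported cutoffs, which are dominated by `|F|`, and use the continuity of
`T` and dominated convergence). [cite: HormanderALPDO1, Thm 2.2.1] -/
theorem apply_eq_integral_of_localDensity (μ : Measure V) [IsFiniteMeasureOnCompacts μ]
    (T : 𝓢(V, ℂ) →L[ℂ] ℂ) {U : Set V} (hU : IsOpen U) {S : V → ℂ} (hS : ContinuousOn S U)
    (hloc : ∀ x ∈ U, ∃ ρ : ℝ, 0 < ρ ∧ ball x ρ ⊆ U ∧
      ∀ F : 𝓢(V, ℂ), tsupport (F : V → ℂ) ⊆ ball x ρ → T F = ∫ y, S y * F y ∂μ)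
    (F : 𝓢(V, ℂ)) (hFU : tsupport (F : V → ℂ) ⊆ U) (hint : Integrable (fun y => S y * F y) μ) :
    T F = ∫ y, S y * F y ∂μ := by
  obtain ⟨u, hu, huF, hule, hupt, hlim⟩ := exists_cutoff_seq F
  -- the left side converges
  have hT : Tendsto (fun m => T (u m)) atTop (𝓝 (T F)) := (T.continuous.tendsto F).comp hlim
  -- the right side converges by dominated convergence
  have hI : Tendsto (fun m => ∫ y, S y * u m y ∂μ) atTop (𝓝 (∫ y, S y * F y ∂μ)) := by
    refine tendsto_integral_of_dominated_convergence (fun y => ‖S y * F y‖) (fun m => ?_) hint.norm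
      (fun m => Eventually.of_forall fun y => ?_) (Eventually.of_forall fun y => ?_)
    · exact (continuous_mul_of_continuousOn_tsupport_subset hU hS (u m).continuous
        ((huF m).trans hFU)).aestronglyMeasurable
    · rw [norm_mul, norm_mul]
      exact mul_le_mul_of_nonneg_left (hule m y) (norm_nonneg _)
    · exact tendsto_const_nhds.mul (hupt y)
  -- and they agree termwise
  have heq : ∀ m, T (u m) = ∫ y, S y * u m y ∂μ := fun m =>
    apply_eq_integral_of_localDensity_of_hasCompactSupport μ T hU hS hloc (u m) (hu m) ((huF m).trans hFU)
  exact tendsto_nhds_unique hT (by simpa [heq] using hI)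

end Literature.MathematicalPhysics.QuantumLattice
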